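import Summits.CriticalPhenomena.PercolationContinuityZ3.Theorems.PercNearOneGluingNoHeavyRsw3AnnulusTwoArmSeparationAspect
import Summits.CriticalPhenomena.PercolationContinuityZ3.Theorems.PercNearOneGluingNoHeavyRsw3AnnulusTwoArmSpongeDichotomy
import Summits.CriticalPhenomena.PercolationContinuityZ3.Theorems.PercNearOneGluingNoHeavyRsw3SlabTwoSpanningCriticalAspect
import HarnessLib

/-!
# RSW3 lane (P2, gen 13): THE SPONGE DICHOTOMY AT EVERY ASPECT — two arms across `Λ(L) ∖ Λ(n)` OR a near-certain thin-way
# crossing of the middle block `{0..2n} × {0..2L}²`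

builds on p205010 (kernel theorem, internal audit signed; external expert review pending)

Cell `prim-rsw3`, prover seat `prim-rsw3-p2` (gen 13), memo `run/shared/lean/prim/rsw3/P2-RSWLITE.md` §20.
Support file (`--supports stmt-CriticalPhenomena-4575`); no definitions, no named facts, no sorries.

Gen 10's `sq_mul_real_compl_boxCross_le_annulusTwoArmProb` is the case `L = 2n`: `σ₂(n)² · P((boxCross (2n,4n,4n) 0)ᶜ) ≤ α₂(n,2n)`.  For a general
outer radius `L > n` the radial blocks `[n,L] × [-n,n]²` are hard boxes when `L > 3n`, so the radial events are LOCALISED (gen 13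
`real_mul_real_mul_le_annulusTwoArmProb`: source patch `{±n} × [-n,n]² ⊂ Λ(n)`, window the whole slab `[±n, ±L] × [-L,L]²`):

  `real_loc_sq_mul_real_compl_boxCross_le_annulusTwoArmProb`:  `σ_loc(n,L)² · P_p((boxCross (2n, 2L, 2L) 0)ᶜ) ≤ annulusTwoArmProb 3 p n L`

for every `p` and `1 ≤ n < L`, where `σ_loc(n,L) = P_p({n}×[-n,n]² ↔ {x₀ = L} in [n,L]×[-L,L]²)`; the middle layer `[-n,n] × [-L,L]²` is sealed for the
paths using only edges with an endpoint strictly between the planes `{x₀ = ±n}` (admissible wall; the plain seal is contained in it).  At `p_c`, for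
every bounded `L/n`, `σ_loc` is bounded below (square-root trick over an easy block), so:  SMALL two-arm probability at aspect `L/n` FORCES
near-certain thin-way crossings of the blocks `(2n; 2L, 2L)` — the input of the every-aspect renormalisation (`…Rsw3AnnulusTwoArmCriticalAspect`).

References: M. Aizenman, Nucl. Phys. B 485 (1997) 551–582, §2 [Aizenman1997]; H. Kesten, *Percolation Theory for Mathematicians* (1982), §3.3, §5.1
[Kesten1982]; G. Grimmett, *Percolation* (1999), §7.2, §11.7 [GrimmettPercolation1999]. [folklore]
-/

noncomputable section

namespace Summit.CriticalPhenomena.PercolationContinuityZ3.Theorems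

open MeasureTheory ProbabilityTheory Filter Topology
open Literature.Probability.Percolation Literature.Probability.LatticeModels
open Literature.Barriers.CriticalPhenomena

namespace Rsw3

open SurfaceTension Crossing

/-! ## The edge-restricted seal of the middle layer is an admissible wall, at every aspect -/

/-- **`σ₊^loc · σ₋^loc · P_p((boxCross (2n, 2L, 2L) 0)ᶜ) ≤ α₂(n, L)` for every `p` and every `1 ≤ n < L`.**  Two localised radial crossings of the
annulus `Λ(L) ∖ Λ(n)` separated by the middle layer `[-n,n] × [-L,L]²` (a translate of the block `{0..2n} × {0..2L}²`) sealed for the paths that use only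
edges with an endpoint strictly between the planes `{x₀ = ±n}`; the edge-restricted seal is an admissible middle-layer event for
`real_mul_real_mul_le_annulusTwoArmProb` and contains the plain seal, whose probability is `1 - σ_p((2n,2L,2L); 0)` by translation invariance. [folklore] -/
theorem real_mul_real_mul_real_compl_boxCross_le_annulusTwoArmProb (p : unitInterval) {n L : ℕ} (hn : 1 ≤ n) (hnL : n + 1 ≤ L) :
    (bondPercolation (zdGraph 3) p).real
        (linked (Set.Icc ![(n : ℤ), -(L : ℤ), -(L : ℤ)] ![(L : ℤ), (L : ℤ), (L : ℤ)])
          (Set.Icc ![(n : ℤ), -(n : ℤ), -(n : ℤ)] ![(n : ℤ), (n : ℤ), (n : ℤ)])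
          (Set.Icc ![(L : ℤ), -(L : ℤ), -(L : ℤ)] ![(L : ℤ), (L : ℤ), (L : ℤ)])) *
      (bondPercolation (zdGraph 3) p).real
        (linked (Set.Icc ![-(L : ℤ), -(L : ℤ), -(L : ℤ)] ![-(n : ℤ), (L : ℤ), (L : ℤ)])
          (Set.Icc ![-(n : ℤ), -(n : ℤ), -(n : ℤ)] ![-(n : ℤ), (n : ℤ), (n : ℤ)])
          (Set.Icc ![-(L : ℤ), -(L : ℤ), -(L : ℤ)] ![-(L : ℤ), (L : ℤ), (L : ℤ)])) *
        (bondPercolation (zdGraph 3) p).real (boxCross ![2 * (n : ℤ), 2 * (L : ℤ), 2 * (L : ℤ)] 0)ᶜ ≤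
      annulusTwoArmProb 3 p n L := by
  classical
  set μ := bondPercolation (zdGraph 3) p with hμ
  -- adapted from `sq_mul_real_compl_boxCross_le_annulusTwoArmProb` (gen 10): general outer radius `L`, localised radial events
  -- the middle layer `R = v + {0..M}`, `v = (-n, -L, -L)`, `M = (2n, 2L, 2L)`
  set M : Site 3 := ![2 * (n : ℤ), 2 * (L : ℤ), 2 * (L : ℤ)] with hM
  set v : Site 3 := ![-(n : ℤ), -(L : ℤ), -(L : ℤ)] with hv
  have hM0 : M 0 = 2 * (n : ℤ) := by simp [hM]
  have hMj : ∀ j : Fin 3, j ≠ 0 → M j = 2 * (L : ℤ) := by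
    intro j hj; fin_cases j <;> simp [hM] at hj ⊢
  have hv0 : v 0 = -(n : ℤ) := by simp [hv]
  have hvj : ∀ j : Fin 3, j ≠ 0 → v j = -(L : ℤ) := by
    intro j hj; fin_cases j <;> simp [hv] at hj ⊢
  set R : Set (Site 3) := {x | ∀ j, v j ≤ x j ∧ x j ≤ v j + M j} with hR
  set A : Set (Site 3) := {x | x ∈ R ∧ x 0 = v 0} with hA
  set B : Set (Site 3) := {x | x 0 = v 0 + M 0} with hB
  set X : Set (BondConfig (Site 3)) := linked R A B with hX
  -- the admissible edge class and the edge-restricted seal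
  set T : Set (Sym2 (Site 3)) := {e | ∃ x ∈ e, |x 0| < (n : ℤ)} with hT
  set W : Set (BondConfig (Site 3)) := {ω | ω ∩ T ∉ X} with hW
  have hWT : DeterminedBy W T := by
    rw [determinedBy_iff]
    intro ω ω' h
    simp only [hW, Set.mem_setOf_eq, h]
  have hmeas : Measurable fun ω : BondConfig (Site 3) => ω ∩ T :=
    measurable_set_iff.2 fun e => (measurable_set_mem e).and measurable_const
  have hXm : MeasurableSet X := measurableSet_linked R A B
  have hWm : MeasurableSet W := by
    have : W = (fun ω : BondConfig (Site 3) => ω ∩ T) ⁻¹' Xᶜ := rfl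
    rw [this]
    exact hXm.compl.preimage hmeas
  have hTn : ∀ e ∈ T, ∃ x ∈ e, |x 0| < (n : ℤ) := fun e he => he
  -- membership in `R` from the coordinate bounds
  have hmemR : ∀ x : Site 3, -(n : ℤ) ≤ x 0 → x 0 ≤ n → x ∈ box 3 L → x ∈ R := by
    intro x h1 h2 hx
    rw [mem_box] at hx
    intro j
    by_cases hj : j = 0
    · subst hj; rw [hv0, hM0]; omega
    · rw [hvj j hj, hMj j hj]; have := hx j; omega
  -- (b) the kill property
  have hkill : ∀ ω, ω ⊆ (zdGraph 3).edgeSet → ω ∈ W → ∀ a b : Site 3, a 0 = -(n : ℤ) → b 0 = n →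
      ¬ (openGraph ω ⊓ withinGraph (zdGraph 3) (↑(box 3 L) : Set (Site 3))).Reachable a b := by
    intro ω _ hWω a b ha hb hab
    apply hWω
    -- the walk and the graph
    set H := openGraph ω ⊓ withinGraph (zdGraph 3) (↑(box 3 L) : Set (Site 3)) with hH
    have hHle : H ≤ zdGraph 3 := fun x y hxy => (withinGraph_adj.1 hxy.2).1
    obtain ⟨Wk⟩ := hab
    -- `s` = first index with `x₀ = n`
    have hex_s : ∃ s : ℕ, Wk.getVert s 0 = n := ⟨Wk.length, by rw [Wk.getVert_length, hb]⟩
    set s := Nat.find hex_s with hs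
    have hs_eq : Wk.getVert s 0 = n := Nat.find_spec hex_s
    have hs_len : s ≤ Wk.length := Nat.find_min' hex_s (by rw [Wk.getVert_length, hb])
    have hs_ne : ∀ r, r < s → Wk.getVert r 0 ≠ n := fun r hr => Nat.find_min hex_s hr
    have hs_lt : ∀ r, r < s → Wk.getVert r 0 < n := by
      intro r hr
      by_contra hge
      push Not at hge
      -- IVT on `[0, r]`: `x₀(0) = -n ≤ n ≤ x₀(r)`
      obtain ⟨j, hj, hjn⟩ := exists_getVert_apply_eq hHle Wk 0 (n : ℤ) 0 r (by omega)
        (by rw [Wk.getVert_zero, ha]; omega) (by rw [zero_add]; exact hge)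
      rw [zero_add] at hjn
      exact hs_ne j (by omega) hjn
    -- `t` = last index `≤ s` with `x₀ = -n`
    set t := Nat.findGreatest (fun r => Wk.getVert r 0 = -(n : ℤ)) s with ht
    have ht_eq : Wk.getVert t 0 = -(n : ℤ) :=
      Nat.findGreatest_spec (P := fun r => Wk.getVert r 0 = -(n : ℤ)) (Nat.zero_le s)
        (by rw [Wk.getVert_zero, ha])
    have ht_le : t ≤ s := Nat.findGreatest_le s
    have ht_lt : t < s := by
      rcases ht_le.lt_or_eq with h | h
      · exact h
      · exfalso; rw [← h, ht_eq] at hs_eq; omega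
    have ht_max : ∀ r, t < r → r ≤ s → Wk.getVert r 0 ≠ -(n : ℤ) := fun r hr hrs =>
      Nat.findGreatest_is_greatest hr hrs
    have ht_gt : ∀ r, t < r → r ≤ s → -(n : ℤ) < Wk.getVert r 0 := by
      intro r hr hrs
      by_contra hge
      push Not at hge
      -- IVT on `[r, s]`: `x₀(r) ≤ -n ≤ n = x₀(s)`
      obtain ⟨j, hj, hjn⟩ := exists_getVert_apply_eq hHle Wk 0 (-(n : ℤ)) r (s - r) (by omega) hge
        (by rw [Nat.add_sub_cancel' hrs, hs_eq]; omega)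
      exact ht_max (r + j) (by omega) (by omega) hjn
    -- every vertex with index in `[t, s]` lies in `R`; membership in `Λ(2n)` from the walk
    have hmem_box : ∀ r, r ≤ Wk.length → 0 < Wk.length → Wk.getVert r ∈ box 3 L := by
      intro r hr hpos
      rcases Nat.lt_or_ge r Wk.length with hlt | hge
      · have hadj := Wk.adj_getVert_succ hlt
        exact Finset.mem_coe.1 (withinGraph_adj.1 hadj.2).2.1
      · have hr' : r = Wk.length := le_antisymm hr hge
        obtain ⟨l, hl⟩ : ∃ l, Wk.length = l + 1 := ⟨Wk.length - 1, by omega⟩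
        have hadj := Wk.adj_getVert_succ (i := l) (by omega)
        rw [← hl] at hadj
        rw [hr']
        exact Finset.mem_coe.1 (withinGraph_adj.1 hadj.2).2.2
    have hlen_pos : 0 < Wk.length := by
      by_contra h0
      push Not at h0
      have h0' : Wk.length = 0 := by omega
      have := hs_len
      rw [h0'] at this
      have hs0 : s = 0 := by omega
      rw [hs0, Wk.getVert_zero, ha] at hs_eq
      omega
    have hR_of : ∀ r, t ≤ r → r ≤ s → Wk.getVert r ∈ R := by
      intro r htr hrs
      refine hmemR _ ?_ ?_ (hmem_box r (hrs.trans hs_len) hlen_pos)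
      · rcases htr.lt_or_eq with h | h
        · exact (ht_gt r h hrs).le
        · rw [← h, ht_eq]
      · rcases hrs.lt_or_eq with h | h
        · exact (hs_lt r h).le
        · rw [h, hs_eq]
    -- adjacency in the restricted graph along `[t, s]`
    set H' := openGraph (ω ∩ T) ⊓ withinGraph (zdGraph 3) R with hH'
    have hadj' : ∀ r, t ≤ r → r < s → H'.Adj (Wk.getVert r) (Wk.getVert (r + 1)) := by
      intro r htr hrs
      have hadj := Wk.adj_getVert_succ (i := r) (by omega)
      obtain ⟨hopen, hwithin⟩ := (SimpleGraph.inf_adj _ _ _ _).1 hadj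
      rw [withinGraph_adj] at hwithin
      obtain ⟨he, hne⟩ := (openGraph_adj ω _ _).1 hopen
      -- some endpoint strictly between the planes
      have hTmem : s(Wk.getVert r, Wk.getVert (r + 1)) ∈ T := by
        rcases htr.lt_or_eq with h | h
        · exact ⟨Wk.getVert r, Sym2.mem_mk_left _ _,
            abs_lt.2 ⟨ht_gt r h (by omega), hs_lt r hrs⟩⟩
        · -- `r = t`: the next vertex is strictly inside, since `t + 1 < s`
          have h2 : t + 1 < s := by
            by_contra hle
            push Not at hle
            have hts : s = t + 1 := by omega
            have h1 := (coord_sub_le_one_of_adj hwithin.1 0).2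
            have e1 : Wk.getVert r 0 = -(n : ℤ) := by rw [← h]; exact ht_eq
            have e2 : Wk.getVert (r + 1) 0 = n := by
              have e := hs_eq
              rw [hts, h] at e
              exact e
            have h1n : (1 : ℤ) ≤ n := by exact_mod_cast hn
            omega
          refine ⟨Wk.getVert (r + 1), Sym2.mem_mk_right _ _, abs_lt.2 ⟨?_, ?_⟩⟩
          · exact ht_gt (r + 1) (by omega) (by omega)
          · exact hs_lt (r + 1) (by omega)
      refine (SimpleGraph.inf_adj _ _ _ _).2 ⟨(openGraph_adj _ _ _).2 ⟨⟨he, hTmem⟩, hne⟩, ?_⟩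
      rw [withinGraph_adj]
      exact ⟨hwithin.1, hR_of r htr (by omega), hR_of (r + 1) (by omega) (by omega)⟩
    have hreach : ∀ k, t + k ≤ s → H'.Reachable (Wk.getVert t) (Wk.getVert (t + k)) := by
      intro k
      induction k with
      | zero => intro _; exact SimpleGraph.Reachable.refl _
      | succ k ih =>
        intro hk
        have h1 := ih (by omega)
        have h2 := (hadj' (t + k) (by omega) (by omega)).reachable
        rw [← add_assoc]
        exact h1.trans h2
    have hts : H'.Reachable (Wk.getVert t) (Wk.getVert s) := by
      have := hreach (s - t) (by omega)
      rwa [Nat.add_sub_cancel' ht_le] at this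
    -- conclude: `ω ∩ T ∈ X`
    rw [hX, mem_linked_iff]
    refine ⟨Wk.getVert t, ⟨hR_of t le_rfl ht_le, by rw [ht_eq, hv0]⟩, Wk.getVert s,
      by show Wk.getVert s 0 = v 0 + M 0; rw [hs_eq, hv0, hM0]; ring, ?_⟩
    rw [mem_inConn_iff]
    exact hts
  -- the localised separation lemma with this wall
  have hmain := real_mul_real_mul_le_annulusTwoArmProb p hn hnL hWT hWm hTn hkill
  -- (c) `P(W) ≥ 1 - P(X) ≥ P((boxCross M 0)ᶜ)`
  have hXW : Xᶜ ⊆ W := by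
    intro ω hω hωT
    exact hω (isUpperSet_linked R A B (Set.inter_subset_left : ω ∩ T ⊆ ω) hωT)
  have hM0' : (0 : ℤ) ≤ M 0 := by rw [hM0]; positivity
  have hXle : μ.real X ≤ μ.real (boxCross M 0) :=
    real_linked_le_real_boxCross p (R := R) (A := A) (B := B) (v := v) (M := M) (L := M) 0
      (fun x hx => hx) (fun x hx => hx.1) (fun x hx => hx.2) (fun x hx => hx) hM0' le_rfl (fun j _ => le_rfl)
  have hXc : μ.real Xᶜ = 1 - μ.real X := probReal_compl_eq_one_sub hXm
  have hBc : μ.real (boxCross M 0)ᶜ = 1 - μ.real (boxCross M 0) :=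
    probReal_compl_eq_one_sub (measurableSet_boxCross M 0)
  have hXW' : μ.real Xᶜ ≤ μ.real W := measureReal_mono hXW (measure_ne_top μ W)
  have hcompl : μ.real (boxCross M 0)ᶜ ≤ μ.real W := by
    rw [hBc]; rw [hXc] at hXW'; linarith
  have h0 : 0 ≤ μ.real
        (linked (Set.Icc ![(n : ℤ), -(L : ℤ), -(L : ℤ)] ![(L : ℤ), (L : ℤ), (L : ℤ)])
          (Set.Icc ![(n : ℤ), -(n : ℤ), -(n : ℤ)] ![(n : ℤ), (n : ℤ), (n : ℤ)])
          (Set.Icc ![(L : ℤ), -(L : ℤ), -(L : ℤ)] ![(L : ℤ), (L : ℤ), (L : ℤ)])) *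
      μ.real
        (linked (Set.Icc ![-(L : ℤ), -(L : ℤ), -(L : ℤ)] ![-(n : ℤ), (L : ℤ), (L : ℤ)])
          (Set.Icc ![-(n : ℤ), -(n : ℤ), -(n : ℤ)] ![-(n : ℤ), (n : ℤ), (n : ℤ)])
          (Set.Icc ![-(L : ℤ), -(L : ℤ), -(L : ℤ)] ![-(L : ℤ), (L : ℤ), (L : ℤ)])) :=
    mul_nonneg measureReal_nonneg measureReal_nonneg
  exact (mul_le_mul_of_nonneg_left hcompl h0).trans hmain

/-- **THE SPONGE DICHOTOMY AT EVERY ASPECT (every `p`, `1 ≤ n < L`):**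
`σ_loc(n,L)² · P_p((boxCross (2n, 2L, 2L) 0)ᶜ) ≤ annulusTwoArmProb 3 p n L`, `σ_loc(n,L) = P_p({n}×[-n,n]² ↔ {x₀ = L} in [n,L]×[-L,L]²)` — two arms
across `Λ(L) ∖ Λ(n)`, or the middle block `(2n; 2L, 2L)` is crossed the thin way (reflection `x₀ ↦ -x₀` identifies the two radial probabilities).
[cite: Aizenman1997, §2 Remark 2] -/
theorem real_loc_sq_mul_real_compl_boxCross_le_annulusTwoArmProb (p : unitInterval) {n L : ℕ} (hn : 1 ≤ n) (hnL : n + 1 ≤ L) :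
    (bondPercolation (zdGraph 3) p).real
        (linked (Set.Icc ![(n : ℤ), -(L : ℤ), -(L : ℤ)] ![(L : ℤ), (L : ℤ), (L : ℤ)])
          (Set.Icc ![(n : ℤ), -(n : ℤ), -(n : ℤ)] ![(n : ℤ), (n : ℤ), (n : ℤ)])
          (Set.Icc ![(L : ℤ), -(L : ℤ), -(L : ℤ)] ![(L : ℤ), (L : ℤ), (L : ℤ)])) ^ 2 *
        (bondPercolation (zdGraph 3) p).real (boxCross ![2 * (n : ℤ), 2 * (L : ℤ), 2 * (L : ℤ)] 0)ᶜ ≤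
      annulusTwoArmProb 3 p n L := by
  have h := real_mul_real_mul_real_compl_boxCross_le_annulusTwoArmProb p hn hnL
  rw [real_linked_radialMinus_eq p n L] at h
  rw [sq]
  exact h

end Rsw3

end Summit.CriticalPhenomena.PercolationContinuityZ3.Theorems

end
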